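import Literature.Analysis.FluidPDE.OseenKernelComplexBounds
import HarnessLib

/-!
# Bounds for the complexified kernels at real times and imaginary displacements in a sector

Analysis/FluidPDE support file (everything proved, no definitions). `OseenKernelComplexBounds.lean`
bounds the complexified Gauss–Weierstrass and Oseen–Koch–Tataru kernels `heatKernelC m ζ`,
`oseenKernelC m ζ a b` (`OseenKernelComplex.lean`, root time `m² = t`) on the admissible set of
the *Galilean* scheme: `m` in the parabolic sector and displacements `ζ = cx z - c` with a complex
shift of at most one parabolic unit, `‖c‖ ≤ ‖m‖`. The *contour-deformation* scheme for local
analyticity (Grujić–Kukavica 1998; Bradshaw–Grujić–Kukavica 2015: analytic continuation of heat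
and Oseen potentials in the space variable, the contour of the space integral being pushed into
the complex domain near the evaluation point and left real far from it) needs a second admissible
set: **real** times `m = ρ > 0` and **purely imaginary** shifts `c = iη`, `η ∈ ℝ^ι`, of size

  `‖η‖ ≤ ‖z‖/2 + ρ`

— one parabolic unit plus half the real displacement (a sector of aperture `< π/4` around the
real directions, in which the Gaussian keeps half of its decay:
`Re (ζ·ζ) = ‖z‖² - ‖η‖² ≥ ‖z‖²/2 - 2ρ²`).
On this set the two geometric inputs of `OseenKernelComplexBounds.lean` hold with the same
constants (`re_quadForm_ge_of_imShift`: `Re (ζ·ζ/4ρ²) ≥ (3/50)‖z‖²/ρ² - 2`;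
`norm_imShift_le_rpow_half`: `‖ζ‖ ≤ (5/2)(τ' + ‖z‖²)^{1/2}`, `τ' = (25/6)ρ²`), so the whole chain
of that file goes through verbatim:

* `norm_heatKernelC_imShift_le`, `norm_oseenWeightAC_imShift_le`, `norm_oseenWeightBC_imShift_le`
  — domination by the real kernels at the dilated time `τ' = (25/6)ρ²`;
* `exists_norm_oseenKernelC_imShift_le` — Koch–Tataru's bound (14),
  `‖oseenKernelC ρ (cx z - iη) a b‖ ≤ C (τ' + ‖z‖²)^{-(d+1)/2} ‖a‖‖b‖`;
* `exists_lintegral_oseenKernelC_imShift_le`, `lintegral_heatKernelC_imShift_le` — the `L¹`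
  bounds, for shifts `η = η(y)` depending on the integration variable (as contour deformations
  produce), admissible pointwise.

## References

* Z. Grujić, I. Kukavica, J. Funct. Anal. 152 (1998) 447–466, §2. [GrujicKukavica1998]
* Z. Bradshaw, Z. Grujić, I. Kukavica, J. Differential Equations 259 (2015), §3, (3.1)–(3.3).
  [BradshawGrujicKukavica2015]
* P. G. Lemarié-Rieusset, *The Navier–Stokes Problem in the 21st Century*, CRC Press 2016,
  proof of Thm. 9.12, pp. 261–263 (the model for the bounds). [LemarieRieusset2016]
-/

noncomputable section

open MeasureTheory Set Filter Metric Real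
open _root_.Topology
open scoped BigOperators ENNReal

namespace Literature.Analysis.FluidPDE

open Literature.Analysis.FunctionSpaces.EuclideanSpace (complexify complexify_apply norm_complexify)
open UnboundedOperators (heatKernel)

variable {ι : Type*} [Fintype ι]

/-! ### Real root times are in the sector -/

/-- A real positive root time `m = ρ` has `Re m = ρ > 0`. [folklore] -/
theorem ofReal_re_pos {ρ : ℝ} (hρ : 0 < ρ) : 0 < ((ρ : ℂ)).re := by simpa using hρ

/-- A real root time lies in the parabolic sector `|Im m| ≤ Re m / 2`. [folklore] -/
theorem ofReal_sector {ρ : ℝ} (hρ : 0 < ρ) : |((ρ : ℂ)).im| ≤ ((ρ : ℂ)).re / 2 := by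
  simp only [Complex.ofReal_im, abs_zero, Complex.ofReal_re]
  linarith

/-! ### The quadratic form for imaginary shifts in the sector -/

section QuadForm

/-- The displacement `ζ = cx z - iη` has `ζ·ζ = ‖z‖² - ‖η‖² - 2i⟪z, η⟫`, so
`Re (ζ·ζ) = ‖z‖² - ‖η‖²`. [folklore] -/
theorem re_cdot_imShift (z η : EuclideanSpace ℝ ι) :
    (cdot (complexify z - Complex.I • complexify η) (complexify z - Complex.I • complexify η)).re =
      ‖z‖ ^ 2 - ‖η‖ ^ 2 := by
  have e : cdot (complexify z - Complex.I • complexify η)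
      (complexify z - Complex.I • complexify η) =
      ((‖z‖ ^ 2 - ‖η‖ ^ 2 : ℝ) : ℂ) + ((-2 * inner ℝ z η : ℝ) : ℂ) * Complex.I := by
    rw [cdot_sub_left, cdot_comm (complexify z) (complexify z - Complex.I • complexify η),
      cdot_comm (Complex.I • complexify η) (complexify z - Complex.I • complexify η),
      cdot_sub_left, cdot_sub_left]
    simp only [cdot_smul_left, cdot_smul_right, cdot_complexify_self, cdot_complexify,
      real_inner_comm z η]
    push_cast
    linear_combination ((‖η‖ : ℂ) ^ 2) * Complex.I_sq
  rw [e, Complex.add_re, Complex.ofReal_re, Complex.re_ofReal_mul, Complex.I_re, mul_zero,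
    add_zero]

/-- **The displacement is at most `(3/2)‖z‖ + ρ` in norm** for admissible imaginary shifts.
[folklore] -/
theorem norm_imShift_le {ρ : ℝ} {z η : EuclideanSpace ℝ ι} (hη : ‖η‖ ≤ ‖z‖ / 2 + ρ) :
    ‖complexify z - Complex.I • complexify η‖ ≤ 3 / 2 * ‖z‖ + ρ :=
  calc ‖complexify z - Complex.I • complexify η‖
      ≤ ‖complexify z‖ + ‖Complex.I • complexify η‖ := norm_sub_le _ _
    _ = ‖z‖ + ‖η‖ := by rw [norm_complexify, norm_smul, Complex.norm_I, one_mul, norm_complexify]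
    _ ≤ 3 / 2 * ‖z‖ + ρ := by linarith

/-- **Lower bound for the real part of the quadratic form** for real root time `ρ` and an
admissible imaginary shift: `Re (ζ·ζ (4ρ²)⁻¹) ≥ (3/50)‖z‖²/ρ² - 2` (indeed
`≥ ‖z‖²/(8ρ²) - 1/2`). [folklore] -/
theorem re_quadForm_ge_of_imShift {ρ : ℝ} (hρ : 0 < ρ) {z η : EuclideanSpace ℝ ι}
    (hη : ‖η‖ ≤ ‖z‖ / 2 + ρ) :
    3 * ‖z‖ ^ 2 / (50 * ((ρ : ℂ)).re ^ 2) - 2 ≤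
      (cdot (complexify z - Complex.I • complexify η) (complexify z - Complex.I • complexify η) *
        ((4 : ℂ) * (ρ : ℂ) ^ 2)⁻¹).re := by
  have hinv : ((4 : ℂ) * (ρ : ℂ) ^ 2)⁻¹ = (((4 * ρ ^ 2)⁻¹ : ℝ) : ℂ) := by push_cast; ring
  rw [hinv, Complex.re_mul_ofReal, re_cdot_imShift, Complex.ofReal_re]
  have hη2 : ‖η‖ ^ 2 ≤ ‖z‖ ^ 2 / 2 + 2 * ρ ^ 2 := by
    have h0 : 0 ≤ ‖η‖ := norm_nonneg _
    nlinarith [norm_nonneg z, sq_nonneg (‖z‖ / 2 - ρ)]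
  have e1 : (3 * ‖z‖ ^ 2 / (50 * ρ ^ 2) - 2) * (4 * ρ ^ 2) = 6 / 25 * ‖z‖ ^ 2 - 8 * ρ ^ 2 := by
    field_simp
    ring
  rw [← div_eq_mul_inv, le_div_iff₀ (by positivity : (0 : ℝ) < 4 * ρ ^ 2), e1]
  nlinarith [sq_nonneg ‖z‖, sq_nonneg ρ]

/-- **The complex Gaussian factor keeps Gaussian decay**:
`‖exp(-ζ·ζ (4ρ²)⁻¹)‖ ≤ e² exp(-(3/50)‖z‖²/ρ²)` for admissible imaginary shifts. [folklore] -/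
theorem norm_exp_neg_quadForm_le_of_imShift {ρ : ℝ} (hρ : 0 < ρ) {z η : EuclideanSpace ℝ ι}
    (hη : ‖η‖ ≤ ‖z‖ / 2 + ρ) :
    ‖Complex.exp (-(cdot (complexify z - Complex.I • complexify η)
        (complexify z - Complex.I • complexify η) * ((4 : ℂ) * (ρ : ℂ) ^ 2)⁻¹))‖ ≤
      Real.exp 2 * Real.exp (-(3 * ‖z‖ ^ 2 / (50 * ((ρ : ℂ)).re ^ 2))) := by
  rw [Complex.norm_exp, Complex.neg_re, ← Real.exp_add]
  exact Real.exp_le_exp.2 (by linarith [re_quadForm_ge_of_imShift hρ hη])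

end QuadForm

/-! ### Domination of the three scalar kernels by the real kernels at the dilated time -/

section Kernels

/-- **The complexified Gaussian against the real one at `τ' = (25/6)ρ²`** for real root time
`ρ` and admissible imaginary shifts:
`‖heatKernelC ρ (cx z - iη)‖ ≤ e² (25/6)^{d/2} G_{τ'}(z)`. [folklore] -/
theorem norm_heatKernelC_imShift_le {ρ : ℝ} (hρ : 0 < ρ) {z η : EuclideanSpace ℝ ι}
    (hη : ‖η‖ ≤ ‖z‖ / 2 + ρ) :
    ‖heatKernelC (ρ : ℂ) (complexify z - Complex.I • complexify η)‖ ≤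
      Real.exp 2 * (25 / 6 : ℝ) ^ ((Fintype.card ι : ℝ) / 2) * heatKernel (25 / 6 * ρ ^ 2) z := by
  have hm : 0 < ((ρ : ℂ)).re := ofReal_re_pos hρ
  have hlam : (0 : ℝ) < 25 / 6 := by norm_num
  unfold heatKernelC UnboundedOperators.heatKernel
  rw [norm_mul, norm_mul, Complex.norm_real, Real.norm_of_nonneg heatConst_pos.le]
  have h1 : ‖(((ρ : ℂ)) ^ Fintype.card ι)⁻¹‖ ≤ (((ρ : ℂ)).re ^ Fintype.card ι)⁻¹ :=
    norm_inv_pow_le hm _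
  have h2 := norm_exp_neg_quadForm_le_of_imShift hρ hη
  have hre : ((ρ : ℂ)).re = ρ := Complex.ofReal_re ρ
  rw [hre] at h1 h2
  have hexp : Real.exp (-(3 * ‖z‖ ^ 2 / (50 * ρ ^ 2))) =
      Real.exp (-‖z‖ ^ 2 / (4 * (25 / 6 * ρ ^ 2))) := by
    congr 1; field_simp; ring
  have hkey := heatConst_mul_inv_pow_eq (ι := ι) hρ hlam
  calc _ ≤ heatConst ι * (ρ ^ Fintype.card ι)⁻¹ *
          (Real.exp 2 * Real.exp (-(3 * ‖z‖ ^ 2 / (50 * ρ ^ 2)))) := by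
        gcongr <;> first
          | exact heatConst_pos.le
          | exact mul_nonneg heatConst_pos.le (by positivity)
    _ = Real.exp 2 * (25 / 6 : ℝ) ^ ((Fintype.card ι : ℝ) / 2) *
          ((4 * π * (25 / 6 * ρ ^ 2)) ^ (-(Module.finrank ℝ (EuclideanSpace ℝ ι) : ℝ) / 2) *
            Real.exp (-‖z‖ ^ 2 / (4 * (25 / 6 * ρ ^ 2)))) := by
        rw [hkey, hexp]; ring

/-- The chain `|Ψ_q(w)| ≤ Ψ_q(Re w) ≤ e² Ψ_q(‖z‖²/(4τ'))` for the quadratic-form argument at real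
root time and admissible imaginary shifts. [folklore] -/
theorem norm_psiWeight_quadForm_le_of_imShift {ρ : ℝ} (hρ : 0 < ρ) {z η : EuclideanSpace ℝ ι}
    (hη : ‖η‖ ≤ ‖z‖ / 2 + ρ) {q : ℝ} (hq : 1 < q) :
    ‖psiWeight q (cdot (complexify z - Complex.I • complexify η)
        (complexify z - Complex.I • complexify η) * ((4 : ℂ) * (ρ : ℂ) ^ 2)⁻¹)‖ ≤
      Real.exp 2 * ∫ σ in Ioi (1 : ℝ), σ ^ (-q) *
        Real.exp (-(‖z‖ ^ 2 / (4 * (25 / 6 * ρ ^ 2)) / σ)) := by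
  set w : ℂ := cdot (complexify z - Complex.I • complexify η)
    (complexify z - Complex.I • complexify η) * ((4 : ℂ) * (ρ : ℂ) ^ 2)⁻¹ with hw
  have h1 := norm_psiWeight_le_real hq w
  have h2 : 3 * ‖z‖ ^ 2 / (50 * ρ ^ 2) - 2 ≤ w.re := by
    have := re_quadForm_ge_of_imShift hρ hη (z := z)
    rwa [Complex.ofReal_re] at this
  have h3 := psi_real_antitone hq h2
  have h4 := psi_real_sub_le hq (‖z‖ ^ 2 / (4 * (25 / 6 * ρ ^ 2))) (by norm_num : (0 : ℝ) ≤ 2)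
  have e : 3 * ‖z‖ ^ 2 / (50 * ρ ^ 2) = ‖z‖ ^ 2 / (4 * (25 / 6 * ρ ^ 2)) := by
    field_simp; ring
  rw [e] at h3
  exact h1.trans (h3.trans h4)

/-- **The first complexified weight against the real one** at real root time and admissible
imaginary shifts: `‖oseenWeightAC ρ (cx z - iη)‖ ≤ e² (25/6)^{d/2+1} A((25/6)ρ², z)`. [folklore] -/
theorem norm_oseenWeightAC_imShift_le {ρ : ℝ} (hρ : 0 < ρ) {z η : EuclideanSpace ℝ ι}
    (hη : ‖η‖ ≤ ‖z‖ / 2 + ρ) :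
    ‖oseenWeightAC (ρ : ℂ) (complexify z - Complex.I • complexify η)‖ ≤
      Real.exp 2 * (25 / 6 : ℝ) ^ ((Fintype.card ι : ℝ) / 2 + 1) *
        oseenWeightA (25 / 6 * ρ ^ 2) z := by
  have hm : 0 < ((ρ : ℂ)).re := ofReal_re_pos hρ
  set τ' : ℝ := 25 / 6 * ρ ^ 2 with hτ'
  have hlam : (0 : ℝ) < 25 / 6 := by norm_num
  have hτ'0 : 0 < τ' := by positivity
  have hq : (1 : ℝ) < Fintype.card ι / 2 + 2 := by
    have : (0 : ℝ) ≤ Fintype.card ι := Nat.cast_nonneg _; linarith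
  unfold oseenWeightAC
  rw [norm_mul, norm_mul, norm_mul, Complex.norm_real, Real.norm_of_nonneg heatConst_pos.le]
  have h1 : ‖(((ρ : ℂ)) ^ Fintype.card ι)⁻¹‖ ≤ (ρ ^ Fintype.card ι)⁻¹ := by
    have := norm_inv_pow_le hm (Fintype.card ι); rwa [Complex.ofReal_re] at this
  have h2 : ‖((4 : ℂ) * ((ρ : ℂ)) ^ 2)⁻¹‖ ≤ (4 * ρ ^ 2)⁻¹ := by
    have := norm_inv_const_mul_pow_le hm (by norm_num : (0 : ℝ) < 4) 2
    rw [Complex.ofReal_re] at this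
    push_cast at this; exact this
  have h3 := norm_psiWeight_quadForm_le_of_imShift hρ hη hq
  rw [psi_real_eq_oseenWeightA hτ'0 z] at h3
  obtain ⟨-, hA0, -⟩ := (exists_oseenWeightA_le (E := (EuclideanSpace ℝ ι))).choose_spec.2 hτ'0 z
  have hkey := heatConst_mul_inv_pow_eq (ι := ι) hρ hlam
  set d : ℝ := (Fintype.card ι : ℝ) with hd
  have hfin : (Module.finrank ℝ (EuclideanSpace ℝ ι) : ℝ) = d := by rw [finrank_euclideanSpace]
  rw [hfin] at hkey h3
  have hpos : 0 < 4 * π * τ' := by positivity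
  have e : (4 * π * τ') ^ (-d / 2) * (4 * π * τ') ^ (d / 2) = 1 := by
    rw [← Real.rpow_add hpos]; ring_nf; exact Real.rpow_zero _
  calc _ ≤ heatConst ι * (ρ ^ Fintype.card ι)⁻¹ * (4 * ρ ^ 2)⁻¹ *
          (Real.exp 2 * ((4 * π * τ') ^ (d / 2) * (4 * τ') * oseenWeightA τ' z)) := by
        gcongr <;> first
          | exact heatConst_pos.le
          | exact mul_nonneg heatConst_pos.le (by positivity)
          | exact mul_nonneg (mul_nonneg heatConst_pos.le (by positivity)) (by positivity)
    _ = Real.exp 2 * ((25 / 6 : ℝ) ^ (d / 2) * (25 / 6)) *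
          ((4 * π * τ') ^ (-d / 2) * (4 * π * τ') ^ (d / 2)) * oseenWeightA τ' z := by
        rw [hkey, hτ']; field_simp
    _ = Real.exp 2 * (25 / 6 : ℝ) ^ (d / 2 + 1) * oseenWeightA τ' z := by
        rw [e, Real.rpow_add hlam, Real.rpow_one]; ring

/-- **The second complexified weight against the real one** at real root time and admissible
imaginary shifts: `‖oseenWeightBC ρ (cx z - iη)‖ ≤ e² (25/6)^{d/2+2} B((25/6)ρ², z)`. [folklore] -/
theorem norm_oseenWeightBC_imShift_le {ρ : ℝ} (hρ : 0 < ρ) {z η : EuclideanSpace ℝ ι}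
    (hη : ‖η‖ ≤ ‖z‖ / 2 + ρ) :
    ‖oseenWeightBC (ρ : ℂ) (complexify z - Complex.I • complexify η)‖ ≤
      Real.exp 2 * (25 / 6 : ℝ) ^ ((Fintype.card ι : ℝ) / 2 + 2) *
        oseenWeightB (25 / 6 * ρ ^ 2) z := by
  have hm : 0 < ((ρ : ℂ)).re := ofReal_re_pos hρ
  set τ' : ℝ := 25 / 6 * ρ ^ 2 with hτ'
  have hlam : (0 : ℝ) < 25 / 6 := by norm_num
  have hτ'0 : 0 < τ' := by positivity
  have hq : (1 : ℝ) < Fintype.card ι / 2 + 3 := by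
    have : (0 : ℝ) ≤ Fintype.card ι := Nat.cast_nonneg _; linarith
  unfold oseenWeightBC
  rw [norm_mul, norm_mul, norm_mul, Complex.norm_real, Real.norm_of_nonneg heatConst_pos.le]
  have h1 : ‖(((ρ : ℂ)) ^ Fintype.card ι)⁻¹‖ ≤ (ρ ^ Fintype.card ι)⁻¹ := by
    have := norm_inv_pow_le hm (Fintype.card ι); rwa [Complex.ofReal_re] at this
  have h2 : ‖((8 : ℂ) * ((ρ : ℂ)) ^ 4)⁻¹‖ ≤ (8 * ρ ^ 4)⁻¹ := by
    have := norm_inv_const_mul_pow_le hm (by norm_num : (0 : ℝ) < 8) 4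
    rw [Complex.ofReal_re] at this
    push_cast at this; exact this
  have h3 := norm_psiWeight_quadForm_le_of_imShift hρ hη hq
  rw [psi_real_eq_oseenWeightB hτ'0 z] at h3
  obtain ⟨-, hB0, -⟩ := (exists_oseenWeightB_le (E := (EuclideanSpace ℝ ι))).choose_spec.2 hτ'0 z
  have hkey := heatConst_mul_inv_pow_eq (ι := ι) hρ hlam
  set d : ℝ := (Fintype.card ι : ℝ) with hd
  have hfin : (Module.finrank ℝ (EuclideanSpace ℝ ι) : ℝ) = d := by rw [finrank_euclideanSpace]
  rw [hfin] at hkey h3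
  have hpos : 0 < 4 * π * τ' := by positivity
  have e : (4 * π * τ') ^ (-d / 2) * (4 * π * τ') ^ (d / 2) = 1 := by
    rw [← Real.rpow_add hpos]; ring_nf; exact Real.rpow_zero _
  calc _ ≤ heatConst ι * (ρ ^ Fintype.card ι)⁻¹ * (8 * ρ ^ 4)⁻¹ *
          (Real.exp 2 * ((4 * π * τ') ^ (d / 2) * (8 * τ' ^ 2) * oseenWeightB τ' z)) := by
        gcongr <;> first
          | exact heatConst_pos.le
          | exact mul_nonneg heatConst_pos.le (by positivity)
          | exact mul_nonneg (mul_nonneg heatConst_pos.le (by positivity)) (by positivity)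
    _ = Real.exp 2 * ((25 / 6 : ℝ) ^ (d / 2) * (25 / 6) ^ 2) *
          ((4 * π * τ') ^ (-d / 2) * (4 * π * τ') ^ (d / 2)) * oseenWeightB τ' z := by
        rw [hkey, hτ']; field_simp
    _ = Real.exp 2 * (25 / 6 : ℝ) ^ (d / 2 + 2) * oseenWeightB τ' z := by
        rw [e, Real.rpow_add hlam, show ((25 / 6 : ℝ)) ^ (2 : ℝ) = (25 / 6) ^ 2 from
          Real.rpow_two _]; ring

end Kernels

/-! ### Koch–Tataru's bound (14) for the kernel at real times and imaginary shifts -/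

section KernelBound

/-- `‖cx z - iη‖ ≤ (5/2) (τ' + ‖z‖²)^{1/2}` for admissible imaginary shifts, `τ' = (25/6)ρ²`
(`ρ ≤ √τ'`, `‖z‖ ≤ √(τ' + ‖z‖²)`). [folklore] -/
theorem norm_imShift_le_rpow_half {ρ : ℝ} (hρ : 0 < ρ) {z η : EuclideanSpace ℝ ι}
    (hη : ‖η‖ ≤ ‖z‖ / 2 + ρ) :
    ‖complexify z - Complex.I • complexify η‖ ≤
      5 / 2 * (25 / 6 * ρ ^ 2 + ‖z‖ ^ 2) ^ (1 / 2 : ℝ) := by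
  set s : ℝ := (25 / 6 * ρ ^ 2 + ‖z‖ ^ 2) ^ (1 / 2 : ℝ) with hs
  have hs0 : 0 ≤ s := Real.rpow_nonneg (by positivity) _
  have hs2 : s ^ 2 = 25 / 6 * ρ ^ 2 + ‖z‖ ^ 2 := by
    rw [hs, ← Real.rpow_natCast, ← Real.rpow_mul (by positivity)]; norm_num
  have hz : ‖z‖ ≤ s := norm_le_add_sq_rpow_half (by positivity) z
  have hρs : ρ ≤ s := by nlinarith [hz, norm_nonneg z, hρ]
  calc ‖complexify z - Complex.I • complexify η‖ ≤ 3 / 2 * ‖z‖ + ρ := norm_imShift_le hη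
    _ ≤ 3 / 2 * s + s := by gcongr
    _ = 5 / 2 * s := by ring

/-- **Koch–Tataru's kernel bound (14) for the complexified kernel at real times and admissible
imaginary shifts**: there is `C = C(ι) > 0` such that for every `ρ > 0`, every `z, η ∈ ℝ^ι` with
`‖η‖ ≤ ‖z‖/2 + ρ` and all `a, b ∈ ℂ^ι`,
`‖oseenKernelC ρ (cx z - iη) a b‖ ≤ C ((25/6)ρ² + ‖z‖²)^{-(d+1)/2} ‖a‖ ‖b‖`. [folklore] -/
theorem exists_norm_oseenKernelC_imShift_le :
    ∃ C : ℝ, 0 < C ∧ ∀ {ρ : ℝ}, 0 < ρ → ∀ {z η : EuclideanSpace ℝ ι}, ‖η‖ ≤ ‖z‖ / 2 + ρ →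
      ∀ (a b : EuclideanSpace ℂ ι),
        ‖oseenKernelC (ρ : ℂ) (complexify z - Complex.I • complexify η) a b‖ ≤
          C * (25 / 6 * ρ ^ 2 + ‖z‖ ^ 2) ^
              (-(((Module.finrank ℝ (EuclideanSpace ℝ ι) : ℝ) + 1) / 2)) * ‖a‖ * ‖b‖ := by
  set d : ℝ := (Module.finrank ℝ (EuclideanSpace ℝ ι) : ℝ) with hd
  have hdι : (Fintype.card ι : ℝ) = d := by rw [hd, finrank_euclideanSpace]
  obtain ⟨C₁, hC₁, hG⟩ := exists_heatKernel_le_rpow (E := (EuclideanSpace ℝ ι)) (d / 2 + 1)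
  obtain ⟨C₂, hC₂, hA⟩ := exists_oseenWeightA_le (E := (EuclideanSpace ℝ ι))
  obtain ⟨C₃, hC₃, hB⟩ := exists_oseenWeightB_le (E := (EuclideanSpace ℝ ι))
  set L : ℝ := (25 / 6 : ℝ) with hL
  have hLpos : 0 < L := by norm_num
  set K₀ : ℝ := Real.exp 2 * L ^ (d / 2) with hK₀
  set K₁ : ℝ := Real.exp 2 * L ^ (d / 2 + 1) with hK₁
  set K₂ : ℝ := Real.exp 2 * L ^ (d / 2 + 2) with hK₂
  refine ⟨5 / 2 * (L / 2) * K₀ * C₁ + 3 * K₁ * C₂ * (5 / 2) + K₂ * C₃ * (5 / 2) ^ 3,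
    by positivity, fun {ρ} hρ {z η} hη a b => ?_⟩
  have hm : 0 < ((ρ : ℂ)).re := ofReal_re_pos hρ
  set τ' : ℝ := L * ρ ^ 2 with hτ'
  have hτ'0 : 0 < τ' := by positivity
  set P : ℝ := τ' + ‖z‖ ^ 2 with hP
  have hP0 : 0 < P := by positivity
  set ζ : (EuclideanSpace ℂ ι) := complexify z - Complex.I • complexify η with hζ
  -- ingredients
  have hζP : ‖ζ‖ ≤ 5 / 2 * P ^ (1 / 2 : ℝ) := norm_imShift_le_rpow_half hρ hη
  have h2m : ‖((2 : ℂ) * ((ρ : ℂ)) ^ 2)⁻¹‖ ≤ (2 * ρ ^ 2)⁻¹ := by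
    have := norm_inv_const_mul_pow_le hm (by norm_num : (0 : ℝ) < 2) 2
    rw [Complex.ofReal_re] at this
    push_cast at this; exact this
  have hGc : ‖heatKernelC (ρ : ℂ) ζ‖ ≤ K₀ * heatKernel τ' z := by
    have := norm_heatKernelC_imShift_le hρ hη; rwa [hdι] at this
  have hAc : ‖oseenWeightAC (ρ : ℂ) ζ‖ ≤ K₁ * oseenWeightA τ' z := by
    have := norm_oseenWeightAC_imShift_le hρ hη; rwa [hdι] at this
  have hBc : ‖oseenWeightBC (ρ : ℂ) ζ‖ ≤ K₂ * oseenWeightB τ' z := by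
    have := norm_oseenWeightBC_imShift_le hρ hη; rwa [hdι] at this
  have hG' := hG hτ'0 z
  have hτe : τ' ^ (d / 2 + 1 - d / 2) = τ' := by ring_nf; exact Real.rpow_one τ'
  rw [hτe] at hG'
  obtain ⟨-, hA0, hAle⟩ := hA hτ'0 z
  obtain ⟨-, hB0, hBle⟩ := hB hτ'0 z
  -- powers of `P`
  have hpow1 : P ^ (-(d / 2 + 1)) * P ^ (1 / 2 : ℝ) = P ^ (-((d + 1) / 2)) := by
    rw [← Real.rpow_add hP0]; ring_nf
  have hpow3 : P ^ (-(d / 2 + 2)) * (P ^ (1 / 2 : ℝ)) ^ 3 = P ^ (-((d + 1) / 2)) := by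
    rw [← Real.rpow_natCast, ← Real.rpow_mul hP0.le, ← Real.rpow_add hP0]; ring_nf
  have hρτ : (2 * ρ ^ 2)⁻¹ = L / 2 / τ' := by rw [hτ']; field_simp
  -- term 1
  have h1 : ‖ζ‖ * ‖((2 : ℂ) * ((ρ : ℂ)) ^ 2)⁻¹‖ * ‖heatKernelC (ρ : ℂ) ζ‖ ≤
      5 / 2 * (L / 2) * K₀ * C₁ * P ^ (-((d + 1) / 2)) := by
    calc ‖ζ‖ * ‖((2 : ℂ) * ((ρ : ℂ)) ^ 2)⁻¹‖ * ‖heatKernelC (ρ : ℂ) ζ‖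
        ≤ (5 / 2 * P ^ (1 / 2 : ℝ)) * (2 * ρ ^ 2)⁻¹ * (K₀ * (C₁ * τ' * P ^ (-(d / 2 + 1)))) := by
          gcongr
          exact hGc.trans (mul_le_mul_of_nonneg_left hG' (by positivity))
      _ = 5 / 2 * (L / 2) * K₀ * C₁ * (P ^ (-(d / 2 + 1)) * P ^ (1 / 2 : ℝ)) := by
          rw [hρτ]; field_simp
      _ = _ := by rw [hpow1]
  -- term 2
  have h2 : 3 * ‖oseenWeightAC (ρ : ℂ) ζ‖ * ‖ζ‖ ≤ 3 * K₁ * C₂ * (5 / 2) * P ^ (-((d + 1) / 2)) := by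
    calc 3 * ‖oseenWeightAC (ρ : ℂ) ζ‖ * ‖ζ‖
        ≤ 3 * (K₁ * (C₂ * P ^ (-(d / 2 + 1)))) * (5 / 2 * P ^ (1 / 2 : ℝ)) := by
          gcongr
          exact hAc.trans (mul_le_mul_of_nonneg_left hAle (by positivity))
      _ = 3 * K₁ * C₂ * (5 / 2) * (P ^ (-(d / 2 + 1)) * P ^ (1 / 2 : ℝ)) := by ring
      _ = _ := by rw [hpow1]
  -- term 3
  have h3 : ‖oseenWeightBC (ρ : ℂ) ζ‖ * ‖ζ‖ ^ 3 ≤ K₂ * C₃ * (5 / 2) ^ 3 * P ^ (-((d + 1) / 2)) := by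
    calc ‖oseenWeightBC (ρ : ℂ) ζ‖ * ‖ζ‖ ^ 3
        ≤ (K₂ * (C₃ * P ^ (-(d / 2 + 2)))) * (5 / 2 * P ^ (1 / 2 : ℝ)) ^ 3 := by
          gcongr
          exact hBc.trans (mul_le_mul_of_nonneg_left hBle (by positivity))
      _ = K₂ * C₃ * (5 / 2) ^ 3 * (P ^ (-(d / 2 + 2)) * (P ^ (1 / 2 : ℝ)) ^ 3) := by ring
      _ = _ := by rw [hpow3]
  calc ‖oseenKernelC (ρ : ℂ) ζ a b‖
      ≤ (‖ζ‖ * ‖((2 : ℂ) * ((ρ : ℂ)) ^ 2)⁻¹‖ * ‖heatKernelC (ρ : ℂ) ζ‖ +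
          3 * ‖oseenWeightAC (ρ : ℂ) ζ‖ * ‖ζ‖ +
          ‖oseenWeightBC (ρ : ℂ) ζ‖ * ‖ζ‖ ^ 3) * ‖a‖ * ‖b‖ := norm_oseenKernelC_le _ ζ a b
    _ ≤ (5 / 2 * (L / 2) * K₀ * C₁ * P ^ (-((d + 1) / 2)) +
          3 * K₁ * C₂ * (5 / 2) * P ^ (-((d + 1) / 2)) +
          K₂ * C₃ * (5 / 2) ^ 3 * P ^ (-((d + 1) / 2))) * ‖a‖ * ‖b‖ := by gcongr
    _ = _ := by ring

end KernelBound

/-! ### `L¹` bounds, for shifts depending on the integration variable -/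

section Integrals

/-- **`L¹` bound for the complexified Oseen kernel against bounded fields** at real root time
`ρ > 0` and pointwise admissible imaginary shifts `η(y)`, `‖η(y)‖ ≤ ‖x - y‖/2 + ρ`: there is
`C = C(ι) > 0` with `∫⁻ ‖oseenKernelC ρ (cx (x - y) - iη(y))[A y, B y]‖ dy ≤ C M_A M_B / ρ`.
[folklore] -/
theorem exists_lintegral_oseenKernelC_imShift_le :
    ∃ C : ℝ, 0 < C ∧ ∀ {ρ : ℝ}, 0 < ρ → ∀ (x : EuclideanSpace ℝ ι)
      {η : EuclideanSpace ℝ ι → EuclideanSpace ℝ ι}, (∀ y, ‖η y‖ ≤ ‖x - y‖ / 2 + ρ) →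
      ∀ {A B : EuclideanSpace ℝ ι → EuclideanSpace ℂ ι} {MA MB : ℝ}, 0 ≤ MA → 0 ≤ MB →
        (∀ y, ‖A y‖ ≤ MA) → (∀ y, ‖B y‖ ≤ MB) →
        ∫⁻ y, ‖oseenKernelC (ρ : ℂ) (complexify (x - y) - Complex.I • complexify (η y))
            (A y) (B y)‖ₑ ≤
          ENNReal.ofReal (C * MA * MB / ρ) := by
  set d : ℝ := (Module.finrank ℝ (EuclideanSpace ℝ ι) : ℝ) with hd
  obtain ⟨C, hC, hK⟩ := exists_norm_oseenKernelC_imShift_le (ι := ι)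
  set M₀ : ℝ := ∫ w : (EuclideanSpace ℝ ι), (1 + ‖w‖ ^ 2) ^ (-((d + 1) / 2)) with hM₀
  have he : d < 2 * ((d + 1) / 2) := by linarith
  have hM₀0 : 0 < M₀ := integral_one_add_norm_sq_rpow_neg_pos he
  have hL : (0 : ℝ) < (25 / 6 : ℝ) ^ (-(1 / 2 : ℝ)) := Real.rpow_pos_of_pos (by norm_num) _
  refine ⟨C * M₀ * (25 / 6 : ℝ) ^ (-(1 / 2 : ℝ)), by positivity,
    fun {ρ} hρ x {η} hη {A B MA MB} hMA hMB hAb hBb => ?_⟩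
  set τ' : ℝ := 25 / 6 * ρ ^ 2 with hτ'
  have hτ'0 : 0 < τ' := by positivity
  -- pointwise domination by the translated majorant
  set g : (EuclideanSpace ℝ ι) → ℝ≥0∞ :=
    fun z => ENNReal.ofReal ((τ' + ‖z‖ ^ 2) ^ (-((d + 1) / 2))) with hg
  have hdom : ∀ y, ‖oseenKernelC (ρ : ℂ) (complexify (x - y) - Complex.I • complexify (η y))
      (A y) (B y)‖ₑ ≤ ENNReal.ofReal (C * MA * MB) * g (x - y) := by
    intro y
    rw [hg, ← ENNReal.ofReal_mul (by positivity), ← ofReal_norm]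
    refine ENNReal.ofReal_le_ofReal ?_
    have hw0 : 0 ≤ C * (τ' + ‖x - y‖ ^ 2) ^ (-((d + 1) / 2)) :=
      mul_nonneg hC.le (Real.rpow_nonneg (by positivity) _)
    calc ‖oseenKernelC (ρ : ℂ) (complexify (x - y) - Complex.I • complexify (η y)) (A y) (B y)‖
        ≤ C * (τ' + ‖x - y‖ ^ 2) ^ (-((d + 1) / 2)) * ‖A y‖ * ‖B y‖ := hK hρ (hη y) _ _
      _ ≤ C * (τ' + ‖x - y‖ ^ 2) ^ (-((d + 1) / 2)) * MA * MB :=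
          mul_le_mul (mul_le_mul_of_nonneg_left (hAb y) hw0) (hBb y) (norm_nonneg _)
            (mul_nonneg hw0 hMA)
      _ = C * MA * MB * (τ' + ‖x - y‖ ^ 2) ^ (-((d + 1) / 2)) := by ring
  have hscal : d / 2 - (d + 1) / 2 = -(1 / 2 : ℝ) := by ring
  have hτpow : τ' ^ (-(1 / 2 : ℝ)) = (25 / 6 : ℝ) ^ (-(1 / 2 : ℝ)) * ρ⁻¹ := by
    rw [hτ', Real.mul_rpow (by norm_num) (by positivity)]
    congr 1
    rw [← Real.rpow_natCast ρ 2, ← Real.rpow_mul hρ.le, ← Real.rpow_neg_one]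
    norm_num
  calc ∫⁻ y, ‖oseenKernelC (ρ : ℂ) (complexify (x - y) - Complex.I • complexify (η y))
        (A y) (B y)‖ₑ
      ≤ ∫⁻ y, ENNReal.ofReal (C * MA * MB) * g (x - y) := lintegral_mono hdom
    _ = ENNReal.ofReal (C * MA * MB) * ∫⁻ y, g y := by
        rw [lintegral_const_mul' _ _ ENNReal.ofReal_ne_top, lintegral_sub_left_eq_self g x]
    _ = ENNReal.ofReal (C * MA * MB) * ENNReal.ofReal (τ' ^ (-(1 / 2 : ℝ)) * M₀) := by
        rw [hg, lintegral_add_norm_sq_rpow_neg he hτ'0, hscal]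
    _ = ENNReal.ofReal (C * M₀ * (25 / 6 : ℝ) ^ (-(1 / 2 : ℝ)) * MA * MB / ρ) := by
        rw [← ENNReal.ofReal_mul (by positivity), hτpow]
        congr 1; field_simp

/-- **`L¹` bound for the complexified Gaussian against a bounded field** at real root time and
pointwise admissible imaginary shifts:
`∫⁻ |heatKernelC ρ (cx (x - y) - iη(y))| ‖F y‖ dy ≤ e² (25/6)^{d/2} M_F`. [folklore] -/
theorem lintegral_heatKernelC_imShift_le {ρ : ℝ} (hρ : 0 < ρ) (x : EuclideanSpace ℝ ι)
    {η : EuclideanSpace ℝ ι → EuclideanSpace ℝ ι} (hη : ∀ y, ‖η y‖ ≤ ‖x - y‖ / 2 + ρ)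
    {F : EuclideanSpace ℝ ι → EuclideanSpace ℂ ι} {MF : ℝ} (hMF : 0 ≤ MF) (hF : ∀ y, ‖F y‖ ≤ MF) :
    ∫⁻ y, ‖heatKernelC (ρ : ℂ) (complexify (x - y) - Complex.I • complexify (η y))‖ₑ * ‖F y‖ₑ ≤
      ENNReal.ofReal (Real.exp 2 * (25 / 6 : ℝ) ^ ((Fintype.card ι : ℝ) / 2) * MF) := by
  set τ' : ℝ := 25 / 6 * ρ ^ 2 with hτ'
  have hτ'0 : 0 < τ' := by positivity
  set K₀ : ℝ := Real.exp 2 * (25 / 6 : ℝ) ^ ((Fintype.card ι : ℝ) / 2) with hK₀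
  have hK₀0 : 0 ≤ K₀ := by positivity
  set g : (EuclideanSpace ℝ ι) → ℝ≥0∞ := fun z => ENNReal.ofReal (heatKernel τ' z) with hg
  have hdom : ∀ y, ‖heatKernelC (ρ : ℂ) (complexify (x - y) - Complex.I • complexify (η y))‖ₑ *
      ‖F y‖ₑ ≤ ENNReal.ofReal (K₀ * MF) * g (x - y) := by
    intro y
    rw [hg, ← ENNReal.ofReal_mul (by positivity), ← ofReal_norm, ← ofReal_norm,
      ← ENNReal.ofReal_mul (norm_nonneg _)]
    refine ENNReal.ofReal_le_ofReal ?_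
    calc ‖heatKernelC (ρ : ℂ) (complexify (x - y) - Complex.I • complexify (η y))‖ * ‖F y‖
        ≤ (K₀ * heatKernel τ' (x - y)) * MF :=
          mul_le_mul (norm_heatKernelC_imShift_le hρ (hη y)) (hF y) (norm_nonneg _)
            (mul_nonneg hK₀0 (UnboundedOperators.heatKernel_pos hτ'0 _).le)
      _ = K₀ * MF * heatKernel τ' (x - y) := by ring
  have hmass : ∫⁻ y, g y = 1 := by
    rw [hg, ← ofReal_integral_eq_lintegral_ofReal
      (UnboundedOperators.integrable_heatKernel_holds hτ'0)
      (Eventually.of_forall fun z => (UnboundedOperators.heatKernel_pos hτ'0 z).le),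
      UnboundedOperators.integral_heatKernel_eq_one_holds hτ'0, ENNReal.ofReal_one]
  calc ∫⁻ y, ‖heatKernelC (ρ : ℂ) (complexify (x - y) - Complex.I • complexify (η y))‖ₑ * ‖F y‖ₑ
      ≤ ∫⁻ y, ENNReal.ofReal (K₀ * MF) * g (x - y) := lintegral_mono hdom
    _ = ENNReal.ofReal (K₀ * MF) * ∫⁻ y, g y := by
        rw [lintegral_const_mul' _ _ ENNReal.ofReal_ne_top, lintegral_sub_left_eq_self g x]
    _ = ENNReal.ofReal (K₀ * MF) := by rw [hmass, mul_one]

end Integrals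

end Literature.Analysis.FluidPDE

end
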